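import Summits.ABC.IUTFork.Joshi.MultiplicativeStructuresJoshi

/-!
# Joshi, *Arithmetic Teichmüller Spaces II½* (arXiv:2305.10398v12) §5.6: the multiplicative structures of two arithmeticoids agree
# (Thm. 5.6.1) and `ϕ` is the `p_v`-th power map (Cor. 5.6.2) — TYPED over slot T-37's `ATS2h.DeformationDatum` and Mathlib's
# `Perfection`; Thm. 5.6.1 DERIVED from per-factor tilt data, the map of Cor. 5.6.2 CONSTRUCTED, nothing asserted

Record file of the abc-iut cell, branch E «type Joshi's construction, test vs S» (rung LADDER-ABC:A2.E; seat abc-iut-E-t38, second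
[J-II½] slot; node ids J2h:Thm5.6.1, J2h:Cor5.6.2 (+ RECORD: J2h:Rmk6.1.3, Rmk6.2.2, Rmk6.2.5) of plan/E/JOSHI-DAG.tsv; sequel of
`Joshi/MultiplicativeStructuresJoshi.lean`, whose carriers (`tildeMonoid = Perfection.submonoid`, `powEquiv`, `tildeOneEquiv`,
`tildeMap`) and conventions are in force). SOURCE: K. Joshi, *Construction of Arithmetic Teichmüller Spaces II½: Deformations of
Number Fields*, arXiv:2305.10398**v12** (UNREFEREED; bib `Joshi2023ATS2half`); locators «p.N l.M» = line M of page file `pNNNN.txt`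
of `HOME/plan/repair/lit/renders/Joshi-arxiv-2305.10398-ATS2half/`. **No side is taken** on [IUTchIII] Cor. 3.12, on Joshi's
claims, or on Mochizuki's report on them; typed ≠ proved; print's assertions are `@[claim "Joshi2023ATS2half" "disputed"]
def … : Prop`, never axioms / instances / Literature facts; what FOLLOWS is proved.

WHAT IS TYPED. Over T-37's `D : ATS2h.DeformationDatum L V Lv Y K G A` (arithmeticoids `y : D.Arith`, residue fields `K v y_v`,
residue characteristics `D.p v` with `p_v = 1` at archimedean `v`, Frobenii `D.frob v` / `D.frobY`; IMPORTED, nothing restated):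
`K̃^×_{v,y} := lim_{x ↦ x^{p_v}} K^×_{y_v}` (`tildeUnitsAt`; READING FLAG (E-ref): print's `K̃_v` at non-archimedean `v` also contains
the absorbing `0`; at archimedean `v` this IS print's «K̃ = K^*», `tildeUnitsAtArchEquiv`); the per-factor tilt data `TiltDatum`
(Lem. 3.1.4 ∘ Def. 5.1.1's `K♭_{y_v} ≃ L̂♭_v`, as DATA — exactly the ingredients the printed proof of Thm. 5.6.1 names); Thm. 5.6.1's
isomorphism `∏_v K̃_{1,v} ≃ ∏_v K̃_{2,v}` CONSTRUCTED from it (`TiltDatum.thm561Iso`) and the printed statement DERIVED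
(`thm561_of_tiltDatum`); the map of Cor. 5.6.2 `(x̃_v)_v ↦ (x̃_v^{p_v})_v` CONSTRUCTED as an automorphism (`powFamily`, identity at
archimedean places: `powFamily_apply_of_arc`) and Cor. 5.6.2 itself — which compares the two sides through print's tacit
identification `ι` of the untilt FIELDS at `y_v` and `ϕ_v(y_v)` — typed as a claim (`Cor562`). RECORD (quoted, not typed):
Rmk. 6.1.3 (p.44 l.11–12: «In [Joshi, 2024] it is shown that one may canonically construct Mochizuki's Hodge Theater (and its
variants) using the datum of any adelic point of 𝔍(X/L)» — [J-III] §10, slots T-34 / E-t32); Rmk. 6.2.2 (p.45 l.31–33) and Rmk. 6.2.5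
(p.45 l.49–54, the classical-Teichmüller analogy) are quoted in the docstrings of `Holomorphoid` (`Joshi/ArithmeticoidCohomology.lean`).
TEST-RELEVANCE NOTE (E-cx; located, not adjudicated): Cor. 5.6.2 («ϕ is the p_v-th power operation on the local multiplicative
monoids», p.35 l.63–66) is the [J-II½] print home, at the level of a number field, of the valuation-RESCALING move (`|x̃^p| = |x̃|^p`)
that E-PLAN §2 isolates as load-bearing (cf. [J-III] Prop. 10.3.3 (2), slot T-34; seat E-t1's `UntiltPoints.IsDilatation`).
Standard axioms only; sorry-free. [claim: Joshi2023ATS2half, status: disputed]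
-/

set_option autoImplicit false

noncomputable section

open Set

namespace Summit.ABC.IUTFork.Joshi.ATS2half

universe u

/-! ## §5.6: Thm. 5.6.1 (multiplicative structures of two arithmeticoids agree) and Cor. 5.6.2 (`ϕ` = `p_v`-th power),
over slot T-37's `ATS2h.DeformationDatum` -/

section Arithmeticoids

open Summit.ABC.IUTFork.Joshi.ATS2h

variable {L : Type} [Field L] {V : Type} {Lv : V → Type} [∀ v, Field (Lv v)] {Y : V → Type}
  [∀ v, TopologicalSpace (Y v)] {K : (v : V) → Y v → Type} [∀ v y, Field (K v y)] [∀ v y, TopologicalSpace (K v y)]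
  {G : V → Type} [∀ v, Group (G v)] {A : V → Type} [∀ v, Group (A v)]
  (D : DeformationDatum L V Lv Y K G A)

/-- **`K̃^×_{v,y} := lim_{x ↦ x^{p_v}} K^×_{y_v}`**, the multiplicative structure of the arithmeticoid's residue field at `v` on UNITS
(§3.1 applied to `K_{y_v}` with the residue characteristic `p_v` of T-37's datum; at archimedean `v`, `p_v = 1` and this is
`K^*_{y_v}` — `tildeOneEquiv`). READING FLAG: print's `K̃_v` at non-archimedean `v` also contains `0`. [claim: Joshi2023ATS2half,
status: disputed] -/
abbrev tildeUnitsAt (v : V) (y : Y v) : Submonoid (ℕ → (K v y)ˣ) :=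
  tildeMonoid (K v y)ˣ (D.p v)

/-- At an archimedean place the multiplicative structure is `K^*` itself (Joshi's «K̃ = K^*», §3.1 p.16 l.35–36; `p_v = 1` by
T-37's `p_arch`). [claim: Joshi2023ATS2half, status: disputed] -/
def tildeUnitsAtArchEquiv {v : V} (hv : v ∈ D.Varc) (y : Y v) : tildeUnitsAt D v y ≃* (K v y)ˣ where
  toFun f := f.1 0
  invFun m := ⟨fun _ => m, fun n => by rw [D.p_arch v hv, pow_one]⟩
  left_inv f := by
    refine Subtype.ext (funext fun n => ?_)
    induction n with
    | zero => rfl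
    | succ n ih =>
      have h := f.2 n
      rw [D.p_arch v hv, pow_one] at h
      change f.1 0 = f.1 (n + 1)
      rw [h]; exact ih
  right_inv _ := rfl
  map_mul' _ _ := rfl

/-- **The per-factor tilt data behind Thm. 5.6.1** (its proof, p.35 l.52: «clear from Lemma 3.1.4, Theorem 3.2.2 and Theorem 5.5.2»):
for each place the multiplicative group `F̃_v` of the fixed tilt `L̂♭_v` and, for each point `y_v`, the identification `K̃^×_{v,y_v} ≃
F̃_v` (Lem. 3.1.4 composed with Def. 5.1.1's `K♭_{y_v} ≃ L̂♭_v`) — as DATA; topological monoids. SIGNATURE.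
[claim: Joshi2023ATS2half, status: disputed] -/
structure TiltDatum (Ft : V → Type) [∀ v, CommGroup (Ft v)] [∀ v, TopologicalSpace (Ft v)] where
  /-- `K̃^×_{v,y} ≃ F̃_v` -/
  tilt : ∀ (v : V) (y : Y v), tildeUnitsAt D v y ≃ₜ* Ft v

variable {D} {Ft : V → Type} [∀ v, CommGroup (Ft v)] [∀ v, TopologicalSpace (Ft v)]

/-- **Thm. 5.6.1's isomorphism, CONSTRUCTED** (p.35 l.37–44: «for each valuation v ∈ V_L one has an isomorphism of the respective
multiplicative structures … In particular … ∏_v K̃_{1,v} ≃ ∏_v K̃_{2,v}»): factorwise `K̃_{1,v} ≃ F̃_v ≃ K̃_{2,v}`, assembled over all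
places. DERIVED from the tilt data. [claim: Joshi2023ATS2half, status: disputed] -/
def TiltDatum.thm561Iso (T : TiltDatum D Ft) (y₁ y₂ : D.Arith) :
    (∀ v, tildeUnitsAt D v (y₁ v)) ≃* (∀ v, tildeUnitsAt D v (y₂ v)) :=
  MulEquiv.piCongrRight fun v => (T.tilt v (y₁ v)).toMulEquiv.trans (T.tilt v (y₂ v)).toMulEquiv.symm

/-- The constructed isomorphism is factorwise the composite through the tilt. [claim: Joshi2023ATS2half, status: disputed] -/
theorem TiltDatum.thm561Iso_apply (T : TiltDatum D Ft) (y₁ y₂ : D.Arith) (x : ∀ v, tildeUnitsAt D v (y₁ v)) (v : V) :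
    T.thm561Iso y₁ y₂ x v = (T.tilt v (y₂ v)).symm (T.tilt v (y₁ v) (x v)) := rfl

/-- **Thm. 5.6.1 AS PRINTED** (p.35 l.37–46): «Let L be a number field and let arith(L)_{y₁}, arith(L)_{y₂} be two arithmeticoids of L.
Then for each valuation v ∈ V_L one has an isomorphism of the respective multiplicative structures of the algebraically closed
perfectoid fields at v in the sense of Theorem 3.2.2. In particular, one has an isomorphism of their respective topological
multiplicative monoids (defined in Section 3.1): ∏_{v∈V_L} K̃_{1,v} ≃ ∏_{v∈V_L} K̃_{2,v}. On the other hand the arithmeticoids arith(L)_{y₁}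
and arith(L)_{y₂} need not be equal or even be topologically equivalent.» (The last sentence is Thm. 5.5.2 (7) / Thm. 6.2.1, typed
elsewhere.) HYPOTHESIS (claim) — DERIVED below from the tilt data. [claim: Joshi2023ATS2half, status: disputed] -/
@[claim "Joshi2023ATS2half" "disputed"]
def Thm561 (D : DeformationDatum L V Lv Y K G A) : Prop :=
  ∀ y₁ y₂ : D.Arith, (∀ v, Nonempty (tildeUnitsAt D v (y₁ v) ≃ₜ* tildeUnitsAt D v (y₂ v))) ∧
    Nonempty ((∀ v, tildeUnitsAt D v (y₁ v)) ≃ₜ* (∀ v, tildeUnitsAt D v (y₂ v)))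

/-- **Thm. 5.6.1 from the tilt data** (= its printed proof: Lem. 3.1.4 factorwise). [claim: Joshi2023ATS2half, status: disputed] -/
theorem thm561_of_tiltDatum (T : TiltDatum D Ft) : Thm561 D := by
  intro y₁ y₂
  have e : ∀ v, tildeUnitsAt D v (y₁ v) ≃ₜ* tildeUnitsAt D v (y₂ v) :=
    fun v => (T.tilt v (y₁ v)).trans (T.tilt v (y₂ v)).symm
  refine ⟨fun v => ⟨e v⟩, ⟨{ MulEquiv.piCongrRight (fun v => (e v).toMulEquiv) with
    continuous_toFun := ?_, continuous_invFun := ?_ }⟩⟩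
  · exact continuous_pi fun v => (e v).continuous_toFun.comp (continuous_apply v)
  · exact continuous_pi fun v => (e v).continuous_invFun.comp (continuous_apply v)

/-- **The map of Cor. 5.6.2, CONSTRUCTED**: `(x̃_v)_{v∈V_L} ↦ (x̃_v^{p_v})_{v∈V_L}` on `∏_v K̃^×_{v,y_v}` — an automorphism (`powEquiv`
factorwise). [claim: Joshi2023ATS2half, status: disputed] -/
def powFamily (D : DeformationDatum L V Lv Y K G A) (y : D.Arith) :
    (∀ v, tildeUnitsAt D v (y v)) ≃* (∀ v, tildeUnitsAt D v (y v)) :=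
  MulEquiv.piCongrRight fun v => powEquiv (K v (y v))ˣ (D.p v)

/-- Coordinates of the Cor. 5.6.2 map: `x_n ↦ x_n^{p_v}`. [claim: Joshi2023ATS2half, status: disputed] -/
theorem powFamily_apply_coe (y : D.Arith) (x : ∀ v, tildeUnitsAt D v (y v)) (v : V) (n : ℕ) :
    ((powFamily D y x v : tildeUnitsAt D v (y v)) : ℕ → (K v (y v))ˣ) n = (x v).1 n ^ D.p v := rfl

/-- **`p_v = 1` at archimedean `v`** (Cor. 5.6.2, p.35 l.53–54: «for v ∈ V^arc_L, let p_v = 1»; T-37's `p_arch`): there the Cor. 5.6.2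
map is the identity. DERIVED. [claim: Joshi2023ATS2half, status: disputed] -/
theorem powFamily_apply_of_arc (y : D.Arith) (x : ∀ v, tildeUnitsAt D v (y v)) {v : V} (hv : v ∈ D.Varc) :
    powFamily D y x v = x v := by
  refine Subtype.ext (funext fun n => ?_)
  rw [powFamily_apply_coe, D.p_arch v hv, pow_one]

/-- **Cor. 5.6.2** (p.35 l.52–66): «In the notation of Theorem 5.6.1, suppose additionally that y₁ = y and y₂ = ϕ(y). For each v ∈ V^non_L,
let p_v be the residue characteristic of v, and for v ∈ V^arc_L, let p_v = 1. Then the topological isomorphism of Theorem 5.6.1 is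
given explicitly by: ∏_v K̃_{1,v} ≃ ∏_v K̃_{2,v} given by (x̃_v)_{v∈V_L} ↦ (x̃^{p_v}_v)_{v∈V_L}, i.e. ϕ is the p_v-th power operation on the
local multiplicative monoids corresponding to y and ϕ(y).» (Proof: «clear from Theorem 5.6.1, Theorem 4.2.3 and Corollary 4.2.5».)
To compare the two sides print tacitly identifies the untilt FIELDS at `y_v` and `ϕ_v(y_v)` (same perfectoid field, tilting
structure twisted by Frobenius); that identification is the parameter `ι`, along which the Thm. 5.6.1 isomorphism `y ↦ ϕ(y)` of
the tilt data `T` is asserted to be the `p_v`-th power map. HYPOTHESIS (claim); its MAP `powFamily` is constructed and proved an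
automorphism above. [claim: Joshi2023ATS2half, status: disputed] -/
@[claim "Joshi2023ATS2half" "disputed"]
def Cor562 (T : TiltDatum D Ft) (ι : ∀ (v : V) (y : Y v), (K v (D.frob v y))ˣ ≃* (K v y)ˣ) : Prop :=
  ∀ (y : D.Arith) (x : ∀ v, tildeUnitsAt D v (y v)) (v : V),
    tildeMap (ι v (y v)) (T.thm561Iso y (D.frobY y) x v) = powFamily D y x v

/-- Under Cor. 5.6.2, at an archimedean place the transported Thm. 5.6.1 isomorphism `y ↦ ϕ(y)` is the identity (`p_v = 1`,
`ϕ_v = 1`). DERIVED. [claim: Joshi2023ATS2half, status: disputed] -/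
theorem cor562_arc (T : TiltDatum D Ft) (ι : ∀ (v : V) (y : Y v), (K v (D.frob v y))ˣ ≃* (K v y)ˣ) (h : Cor562 T ι)
    (y : D.Arith) (x : ∀ v, tildeUnitsAt D v (y v)) {v : V} (hv : v ∈ D.Varc) :
    tildeMap (ι v (y v)) (T.thm561Iso y (D.frobY y) x v) = x v := by
  rw [h y x v, powFamily_apply_of_arc y x hv]

end Arithmeticoids

end Summit.ABC.IUTFork.Joshi.ATS2half

end
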